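import Summits.QuantumFields.YangMills.Theses.BalabanUVNodes
import Literature.MathematicalPhysics.QuantumFieldTheory.Balaban1983to89.Node00.Record13SepCoPRInhabitedOfSepCoP

/-!
# YM-PLAN Track A — K0⁶ `Record13SepCoPRInhabited` (stmt-QuantumFields-20506, route `BalabanUVNodes` rev 22∕23) FROM K0⁵ `Record13SepCoPInhabited` (stmt-QuantumFields-20293, aside since
# rev 22), AT THE TEXT LEVEL, with the CURED witness (director-ym №174 (5); FINDING №8)

Cell `pub-ymgap`, seat `pub-ymgap-node00-def-K0a` (g9), Summits-side helper for K0⁶ (count-neutral; `--supports stmt-QuantumFields-20506`).  plan g69 IMPACT-169 ADDENDUM: «K0⁶ ⇐ K0⁵ by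
the run-blind embedding, modulo one bridge lemma»; node00-def-K0a FILE 18 (`Node00/Record13SepCoPRInhabitedOfSepCoP`, p531386 ✓): the bridge at the Literature level, at the CURED pin
`Stage13RParams.ofCured F N θ₀ := ⟨θ₀, ZrOfRecord₁₃ F N θ₀⟩` (dag-n11-d's diagonal cure, FILE 17 p529638 ✓) AND at def-T's run-blind embedding.  This file states the implication between
the two ROUTE DECLS verbatim, so that the planners' sentence is a kernel-checked theorem BY NAME: `Record13SepCoPRInhabited_of_record13SepCoPInhabited`.

HONEST FRAMING.  One-line compositions; K0⁵ is NOT proved here (it is a hypothesis), hence K0⁶ is NOT closed here; nothing of Bałaban asserted; counts unmoved (typed 28∕28 · discharged 5∕28);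
one finite 𝕋⁴ programme at fixed ε — NOT continuum ∕ OS ∕ mass gap ∕ Clay.  No `sorry`, `axiom`, `def`, `instance`, `notation`.
-/

namespace Summit.QuantumFields.YangMills.Theorems.BalabanUVNodesK0RInhabitedOfK0

open Summit.QuantumFields.YangMills.Theses.BalabanUVNodes
open Literature.MathematicalPhysics.QuantumFieldTheory.Balaban1983to89 Node00

/-- **K0⁶ ⇐ K0⁵ AT THE CURED PIN** (route decls verbatim): every v1.5 K0 inhabitant `θ₀` for the family `F` gives the v1.6 inhabitant `⟨θ₀, ZrOfRecord₁₃ F 2 θ₀⟩` — provisos by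
K0a FILE 18 `Stage13Params.Provisos₁₃SepCoP.ofCured`, `ZrUnity` hypothesis-free (`finsum_ζ0_ZrOfRecord₁₃`), slot non-degeneracy and admissibility read `θ₀`.  A REDUCTION between the two
crux texts — neither is proved here. [cite: Balaban1988Convergent, Thm 1 p.262, (1.11) p.248, (3.16)–(3.20) pp.268–269 (bookkeeping)] -/
theorem Record13SepCoPRInhabited_of_record13SepCoPInhabited (h : Record13SepCoPInhabited) : Record13SepCoPRInhabited :=
  fun F => exists_k0SepCoPR_of_exists_k0SepCoP F (h F)

/-- **K0⁶ ⇐ K0⁵ ALONG def-T's RUN-BLIND EMBEDDING** (`Stage13RParams.ofRunBlind`, FILE 25∕26T §R; plan g69 Q4) — the same reduction with the run-blind witness `⟨θ₀, fun p => θ₀.Zt p.K⟩`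
(NOT the pin of record: at it N11's k = 0 clause still owes the unprinted g₀-uniform matching). [cite: Balaban1988Convergent, (3.16) p.268 (bookkeeping)] -/
theorem Record13SepCoPRInhabited_of_record13SepCoPInhabited_runBlind (h : Record13SepCoPInhabited) : Record13SepCoPRInhabited :=
  fun F => exists_k0SepCoPR_runBlind_of_exists_k0SepCoP F (h F)

end Summit.QuantumFields.YangMills.Theorems.BalabanUVNodesK0RInhabitedOfK0
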